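import Mathlib
import Summits.ValiantsHypothesis.ValiantsHypothesis.Theorems.LiouvilleSarnakAlignedTypeICharactersMod2nTwistedLiouville
import HarnessLib
import Literature.NumberTheory.LFunctions.MoebiusCharacterSumsPowerfulModuli

/-!
# Route LiouvilleSarnak — support `AlignedTypeI` (stmt-ValiantsHypothesis-21040), line `characters_mod_2n`:
# stub `stub_twistedLiouvilleSmall` from Banks–Shparlinski 2019, Theorem 2.2 (named fact)

The companion file `…CharactersMod2nTwistedLiouville.lean` reduced the registered stub
`stub_twistedLiouvilleSmall : TwistedLiouvilleSmall` to a statement about the Möbius function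
(`twistedLiouvilleSmall_of_moebius`): Möbius sums twisted by Dirichlet characters to `2`-power moduli `2^t ≤ y` are
`o(y)`, uniformly.  This file derives that Möbius statement — hence `TwistedLiouvilleSmall` BY NAME
(`twistedLiouvilleSmall_of_BS`) — from ONE named fact, NOT proved in the tree:

> W. D. Banks, I. E. Shparlinski, *Sums with the Möbius function twisted by characters with powerful moduli*,
> Trans. Amer. Math. Soc. 373 (2019/2020) 249–272, doi:10.1090/tran/7914 = arXiv:1801.10276 (held), §2, **Theorem 2.2**
> (quoted in the docstring of the fact below; `M(x, χ) = Σ_{n ≤ x} μ(n) χ(n)`), with the remark following it: for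
> `q = 2^γ` every character mod `q` is primitive to its conductor `q₀ = 2^{γ'}`, and the theorem applies with `q₀`
> in place of `q` when `q₀ ≥ 2^{γ₀}`;

plus, for the finitely many conductors `2^{γ'} < 2^{γ₁}`, Green 2012 Thm 3 (= Montgomery–Vaughan §11.3.1 Exercise 7
for `2`-power moduli), i.e. the tree's PROVED `Literature.NumberTheory.LFunctions.LiouvilleTwoPower.norm_sum_moebius_character_le`.

HONEST FRAMING. `twistedLiouvilleSmall_of_BS` is CONDITIONAL on the named fact (no `_holds` in the tree: its proof
is the Postnikov–Gallagher–Iwaniec / Banks–Shparlinski zero-free region for `L(s, χ mod 2^γ)` plus the explicit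
formula); the registered stub is therefore NOT closed unconditionally, `AlignedTypeI` is not closed, and nothing here
bears on `VP ≠ VNP` (NOT proved).
-/

set_option linter.dupNamespace false

noncomputable section

namespace Summit.ValiantsHypothesis.ValiantsHypothesis.Theorems.LiouvilleSarnak.AlignedTypeI.CharactersModTwoN

open ArithmeticFunction Finset Filter
open scoped BigOperators ArithmeticFunction.Moebius

/-! ## §1 The named fact: Banks–Shparlinski 2019, Theorem 2.2, for `q = 2^γ` (Möbius part) -/

/-- `L · exp(-a L^{1/3} (log L)^{-4/3}) ≤ η` for all large `L` (`a, η > 0`): since `(log L)^{7/3} = o(L^{1/3})`,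
eventually `a L^{1/3} (log L)^{-4/3} ≥ 2 log L`, so the left side is `≤ L · L^{-2} = 1/L`. [folklore] -/
theorem mul_exp_neg_rpow_third_le (a : ℝ) (ha : 0 < a) (η : ℝ) (hη : 0 < η) :
    ∃ L₀ : ℝ, ∀ L : ℝ, L₀ ≤ L →
      L * Real.exp (-(a * L ^ (1 / 3 : ℝ) * Real.log L ^ (-(4 / 3 : ℝ)))) ≤ η := by
  obtain ⟨L₁, hL₁⟩ := Filter.eventually_atTop.mp
    ((isLittleO_log_rpow_rpow_atTop (7 / 3 : ℝ) (by norm_num : (0 : ℝ) < 1 / 3)).bound (half_pos ha))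
  refine ⟨max L₁ (max (Real.exp 1) (1 / η)), fun L hL => ?_⟩
  have hLe : Real.exp 1 ≤ L := le_trans ((le_max_left _ _).trans (le_max_right _ _)) hL
  have hLη : 1 / η ≤ L := le_trans ((le_max_right _ _).trans (le_max_right _ _)) hL
  have hL0 : 0 < L := lt_of_lt_of_le (Real.exp_pos 1) hLe
  have hlog1 : 1 ≤ Real.log L := by
    rw [← Real.log_exp 1]; exact Real.log_le_log (Real.exp_pos 1) hLe
  have hlog0 : 0 < Real.log L := by linarith
  -- `(log L)^{7/3} ≤ (a/2) L^{1/3}`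
  have h1 : Real.log L ^ (7 / 3 : ℝ) ≤ a / 2 * L ^ (1 / 3 : ℝ) := by
    have := hL₁ L (le_trans (le_max_left _ _) hL)
    rwa [Real.norm_of_nonneg (Real.rpow_nonneg hlog0.le _),
      Real.norm_of_nonneg (Real.rpow_nonneg hL0.le _)] at this
  -- hence `2 log L ≤ a L^{1/3} (log L)^{-4/3}`
  have h2 : 2 * Real.log L ≤ a * L ^ (1 / 3 : ℝ) * Real.log L ^ (-(4 / 3 : ℝ)) := by
    have hsplit : Real.log L = Real.log L ^ (7 / 3 : ℝ) * Real.log L ^ (-(4 / 3 : ℝ)) := by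
      rw [← Real.rpow_add hlog0]; norm_num
    have hpos : 0 ≤ Real.log L ^ (-(4 / 3 : ℝ)) := Real.rpow_nonneg hlog0.le _
    calc 2 * Real.log L = 2 * Real.log L ^ (7 / 3 : ℝ) * Real.log L ^ (-(4 / 3 : ℝ)) := by
          conv_lhs => rw [hsplit]
          ring
      _ ≤ 2 * (a / 2 * L ^ (1 / 3 : ℝ)) * Real.log L ^ (-(4 / 3 : ℝ)) := by gcongr
      _ = a * L ^ (1 / 3 : ℝ) * Real.log L ^ (-(4 / 3 : ℝ)) := by ring
  -- so `exp(-…) ≤ exp(-2 log L) = L^{-2}`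
  have h3 : Real.exp (-(a * L ^ (1 / 3 : ℝ) * Real.log L ^ (-(4 / 3 : ℝ)))) ≤ (L * L)⁻¹ := by
    calc Real.exp (-(a * L ^ (1 / 3 : ℝ) * Real.log L ^ (-(4 / 3 : ℝ))))
        ≤ Real.exp (-(2 * Real.log L)) := Real.exp_le_exp.mpr (by linarith)
      _ = (L * L)⁻¹ := by
          rw [Real.exp_neg, show 2 * Real.log L = Real.log L + Real.log L by ring, Real.exp_add,
            Real.exp_log hL0]
  calc L * Real.exp (-(a * L ^ (1 / 3 : ℝ) * Real.log L ^ (-(4 / 3 : ℝ))))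
      ≤ L * (L * L)⁻¹ := mul_le_mul_of_nonneg_left h3 hL0.le
    _ = 1 / L := by field_simp
    _ ≤ η := by
        rw [div_le_iff₀ hL0]
        have := (div_le_iff₀ hη).mp hLη
        linarith

/-! ## §3 The large-conductor range from the fact -/

/-- In each of the three ranges of Theorem 2.2 the saving is at least `e^{-c L^{1/3} (log L)^{-4/3}}` up to the
factor `L = log x ≥ log q =: ℓ > e`: the three exponents dominate `c L^{1/3} (log L)^{-4/3}`. [folklore] -/
theorem bs_ranges_le {c ℓ L Q₁ Q₂ x : ℝ} (hc : 0 < c) (hℓ : Real.exp 1 < ℓ) (hℓL : ℓ ≤ L) :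
    (if x ≤ Q₁ then Real.exp (-(c * L * ℓ ^ (-(2 / 3 : ℝ)) * Real.log ℓ ^ (-(4 / 3 : ℝ)))) * L
      else if x ≤ Q₂ then Real.exp (-(c * (L * ℓ) ^ (1 / 2 : ℝ) * Real.log ℓ ^ (-(1 / 2 : ℝ))))
      else Real.exp (-(c * L ^ (4 / 7 : ℝ) * Real.log L ^ (-(3 / 7 : ℝ))))) ≤
      L * Real.exp (-(c * L ^ (1 / 3 : ℝ) * Real.log L ^ (-(4 / 3 : ℝ)))) := by
  have he0 : 0 < Real.exp 1 := Real.exp_pos 1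
  have hℓ0 : 0 < ℓ := he0.trans hℓ
  have hL0 : 0 < L := hℓ0.trans_le hℓL
  have hℓ1 : 1 < ℓ := lt_trans (by have := Real.add_one_le_exp (1 : ℝ); linarith) hℓ
  have hL1 : 1 ≤ L := hℓ1.le.trans hℓL
  have hlogℓ1 : 1 < Real.log ℓ := by
    rw [← Real.log_exp 1]; exact Real.log_lt_log he0 hℓ
  have hlogℓ0 : 0 < Real.log ℓ := by linarith
  have hlogL : Real.log ℓ ≤ Real.log L := Real.log_le_log hℓ0 hℓL
  have hlogL1 : 1 ≤ Real.log L := hlogℓ1.le.trans hlogL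
  have hlogL0 : 0 < Real.log L := by linarith
  set g : ℝ := c * L ^ (1 / 3 : ℝ) * Real.log L ^ (-(4 / 3 : ℝ)) with hg
  have hexp_le_L : Real.exp (-g) ≤ L * Real.exp (-g) := by
    have := Real.exp_pos (-g)
    nlinarith
  split_ifs with h1 h2
  · -- range 1: `c L ℓ^{-2/3} (log ℓ)^{-4/3} ≥ c L L^{-2/3} (log L)^{-4/3} = g`
    have hA : L ^ (-(2 / 3 : ℝ)) ≤ ℓ ^ (-(2 / 3 : ℝ)) :=
      Real.rpow_le_rpow_of_nonpos hℓ0 hℓL (by norm_num)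
    have hB : Real.log L ^ (-(4 / 3 : ℝ)) ≤ Real.log ℓ ^ (-(4 / 3 : ℝ)) :=
      Real.rpow_le_rpow_of_nonpos hlogℓ0 hlogL (by norm_num)
    have hLsplit : L ^ (1 / 3 : ℝ) = L * L ^ (-(2 / 3 : ℝ)) := by
      rw [show L * L ^ (-(2 / 3 : ℝ)) = L ^ (1 : ℝ) * L ^ (-(2 / 3 : ℝ)) by rw [Real.rpow_one],
        ← Real.rpow_add hL0]
      norm_num
    have hge : g ≤ c * L * ℓ ^ (-(2 / 3 : ℝ)) * Real.log ℓ ^ (-(4 / 3 : ℝ)) := by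
      rw [hg, hLsplit]
      have h0 : 0 ≤ c * L := by positivity
      calc c * (L * L ^ (-(2 / 3 : ℝ))) * Real.log L ^ (-(4 / 3 : ℝ))
          = c * L * (L ^ (-(2 / 3 : ℝ)) * Real.log L ^ (-(4 / 3 : ℝ))) := by ring
        _ ≤ c * L * (ℓ ^ (-(2 / 3 : ℝ)) * Real.log ℓ ^ (-(4 / 3 : ℝ))) := by
            refine mul_le_mul_of_nonneg_left ?_ h0
            exact mul_le_mul hA hB (Real.rpow_nonneg hlogL0.le _) (Real.rpow_nonneg hℓ0.le _)
        _ = c * L * ℓ ^ (-(2 / 3 : ℝ)) * Real.log ℓ ^ (-(4 / 3 : ℝ)) := by ring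
    calc Real.exp (-(c * L * ℓ ^ (-(2 / 3 : ℝ)) * Real.log ℓ ^ (-(4 / 3 : ℝ)))) * L
        ≤ Real.exp (-g) * L := by gcongr
      _ = L * Real.exp (-g) := mul_comm _ _
  · -- range 2: `c (Lℓ)^{1/2} (log ℓ)^{-1/2} ≥ c L^{1/2} (log L)^{-1/2} ≥ g`
    have hA : L ^ (1 / 2 : ℝ) ≤ (L * ℓ) ^ (1 / 2 : ℝ) := by
      refine Real.rpow_le_rpow hL0.le ?_ (by norm_num)
      nlinarith
    have hB : Real.log L ^ (-(1 / 2 : ℝ)) ≤ Real.log ℓ ^ (-(1 / 2 : ℝ)) :=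
      Real.rpow_le_rpow_of_nonpos hlogℓ0 hlogL (by norm_num)
    -- `L^{1/3} (log L)^{-4/3} ≤ L^{1/2} (log L)^{-1/2}`
    have hC : L ^ (1 / 3 : ℝ) * Real.log L ^ (-(4 / 3 : ℝ)) ≤ L ^ (1 / 2 : ℝ) * Real.log L ^ (-(1 / 2 : ℝ)) := by
      refine mul_le_mul (Real.rpow_le_rpow_of_exponent_le hL1 (by norm_num))
        (Real.rpow_le_rpow_of_exponent_le hlogL1 (by norm_num)) (Real.rpow_nonneg hlogL0.le _)
        (Real.rpow_nonneg hL0.le _)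
    have hge : g ≤ c * (L * ℓ) ^ (1 / 2 : ℝ) * Real.log ℓ ^ (-(1 / 2 : ℝ)) := by
      rw [hg]
      calc c * L ^ (1 / 3 : ℝ) * Real.log L ^ (-(4 / 3 : ℝ)) = c * (L ^ (1 / 3 : ℝ) * Real.log L ^ (-(4 / 3 : ℝ))) := by
            ring
        _ ≤ c * (L ^ (1 / 2 : ℝ) * Real.log L ^ (-(1 / 2 : ℝ))) := mul_le_mul_of_nonneg_left hC hc.le
        _ ≤ c * ((L * ℓ) ^ (1 / 2 : ℝ) * Real.log ℓ ^ (-(1 / 2 : ℝ))) := by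
            refine mul_le_mul_of_nonneg_left ?_ hc.le
            exact mul_le_mul hA hB (Real.rpow_nonneg hlogL0.le _) (Real.rpow_nonneg (by positivity) _)
        _ = c * (L * ℓ) ^ (1 / 2 : ℝ) * Real.log ℓ ^ (-(1 / 2 : ℝ)) := by ring
    calc Real.exp (-(c * (L * ℓ) ^ (1 / 2 : ℝ) * Real.log ℓ ^ (-(1 / 2 : ℝ))))
        ≤ Real.exp (-g) := Real.exp_le_exp.mpr (by linarith)
      _ ≤ L * Real.exp (-g) := hexp_le_L
  · -- range 3: `c L^{4/7} (log L)^{-3/7} ≥ g`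
    have hC : L ^ (1 / 3 : ℝ) * Real.log L ^ (-(4 / 3 : ℝ)) ≤ L ^ (4 / 7 : ℝ) * Real.log L ^ (-(3 / 7 : ℝ)) := by
      refine mul_le_mul (Real.rpow_le_rpow_of_exponent_le hL1 (by norm_num))
        (Real.rpow_le_rpow_of_exponent_le hlogL1 (by norm_num)) (Real.rpow_nonneg hlogL0.le _)
        (Real.rpow_nonneg hL0.le _)
    have hge : g ≤ c * L ^ (4 / 7 : ℝ) * Real.log L ^ (-(3 / 7 : ℝ)) := by
      rw [hg]
      calc c * L ^ (1 / 3 : ℝ) * Real.log L ^ (-(4 / 3 : ℝ)) = c * (L ^ (1 / 3 : ℝ) * Real.log L ^ (-(4 / 3 : ℝ))) := by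
            ring
        _ ≤ c * (L ^ (4 / 7 : ℝ) * Real.log L ^ (-(3 / 7 : ℝ))) := mul_le_mul_of_nonneg_left hC hc.le
        _ = c * L ^ (4 / 7 : ℝ) * Real.log L ^ (-(3 / 7 : ℝ)) := by ring
    calc Real.exp (-(c * L ^ (4 / 7 : ℝ) * Real.log L ^ (-(3 / 7 : ℝ))))
        ≤ Real.exp (-g) := Real.exp_le_exp.mpr (by linarith)
      _ ≤ L * Real.exp (-g) := hexp_le_L

/-- **Large conductors, from Banks–Shparlinski Thm 2.2.**  CONDITIONAL on the named fact: there is `γ₁` such that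
for every `ε > 0` and all real `y ≥ y₀(ε)`, every `γ ≥ γ₁` with `2^γ ≤ y` and every PRIMITIVE character `χ` mod
`2^γ` satisfy `‖Σ_{n ≤ y} μ(n) χ(n)‖ ≤ ε y` (uniformly: `log q ≤ log y` makes all three ranges of `E₁` at most
`L e^{-c L^{1/3} (log L)^{-4/3}}`, `L = log y`). [cite: BanksShparlinski2019PowerfulModuli, Theorem 2.2] -/
theorem moebius_twisted_le_of_BS_large (hBS : Literature.NumberTheory.LFunctions.BanksShparlinski2019_theorem22_twoPower) :
    ∃ γ₁ : ℕ, ∀ ε : ℝ, 0 < ε → ∃ y₀ : ℝ, ∀ y : ℝ, y₀ ≤ y → ∀ γ : ℕ, γ₁ ≤ γ → (2 : ℝ) ^ γ ≤ y →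
      ∀ χ : DirichletCharacter ℂ (2 ^ γ), χ.IsPrimitive →
        ‖∑ n ∈ Ioc 0 ⌊y⌋₊, ((μ n : ℤ) : ℂ) * χ (n : ZMod (2 ^ γ))‖ ≤ ε * y := by
  obtain ⟨γ₀, c, hc, C, h⟩ := hBS
  refine ⟨max γ₀ 5, fun ε hε => ?_⟩
  have hC1 : 0 < max C 0 + 1 := by positivity
  obtain ⟨L₀, hL₀⟩ := mul_exp_neg_rpow_third_le c hc (ε / (max C 0 + 1)) (by positivity)
  refine ⟨max (Real.exp L₀) 2, fun y hy γ hγ hγy χ hχ => ?_⟩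
  have hy2 : (2 : ℝ) ≤ y := le_trans (le_max_right _ _) hy
  have hy0 : 0 < y := by linarith
  have hγ5 : 5 ≤ γ := le_trans (le_max_right _ _) hγ
  have hγ0 : γ₀ ≤ γ := le_trans (le_max_left _ _) hγ
  have hq0 : (0 : ℝ) < (2 : ℝ) ^ γ := by positivity
  have hℓ : Real.exp 1 < Real.log ((2 : ℝ) ^ γ) := by
    rw [Real.log_pow]
    calc Real.exp 1 < 5 * Real.log 2 := by linarith [Real.exp_one_lt_d9, Real.log_two_gt_d9]
      _ ≤ (γ : ℕ) * Real.log 2 := by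
          gcongr
          exact_mod_cast hγ5
  have hℓL : Real.log ((2 : ℝ) ^ γ) ≤ Real.log y := Real.log_le_log hq0 hγy
  have hLL₀ : L₀ ≤ Real.log y := by
    rw [← Real.log_exp L₀]; exact Real.log_le_log (Real.exp_pos _) (le_trans (le_max_left _ _) hy)
  have hB := h γ hγ0 χ hχ y hy2
  have hR := bs_ranges_le (c := c) (x := y)
    (Q₁ := Real.exp (Real.log ((2 : ℝ) ^ γ) ^ (7 / 3 : ℝ) * Real.log (Real.log ((2 : ℝ) ^ γ)) ^ (5 / 3 : ℝ)))
    (Q₂ := Real.exp (Real.log ((2 : ℝ) ^ γ) ^ (7 : ℝ) * (Real.log (Real.log ((2 : ℝ) ^ γ)))⁻¹)) hc hℓ hℓL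
  have hD := hL₀ (Real.log y) hLL₀
  set E : ℝ := (if y ≤ Real.exp (Real.log ((2 : ℝ) ^ γ) ^ (7 / 3 : ℝ) * Real.log (Real.log ((2 : ℝ) ^ γ)) ^ (5 / 3 : ℝ))
            then Real.exp (-(c * Real.log y * Real.log ((2 : ℝ) ^ γ) ^ (-(2 / 3 : ℝ)) *
                    Real.log (Real.log ((2 : ℝ) ^ γ)) ^ (-(4 / 3 : ℝ)))) * Real.log y
          else if y ≤ Real.exp (Real.log ((2 : ℝ) ^ γ) ^ (7 : ℝ) * (Real.log (Real.log ((2 : ℝ) ^ γ)))⁻¹)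
            then Real.exp (-(c * (Real.log y * Real.log ((2 : ℝ) ^ γ)) ^ (1 / 2 : ℝ) *
                    Real.log (Real.log ((2 : ℝ) ^ γ)) ^ (-(1 / 2 : ℝ))))
          else Real.exp (-(c * Real.log y ^ (4 / 7 : ℝ) * Real.log (Real.log y) ^ (-(3 / 7 : ℝ))))) with hE
  have hE0 : 0 ≤ E := by
    rw [hE]
    split_ifs
    · exact mul_nonneg (Real.exp_pos _).le (Real.log_nonneg (by linarith))
    · exact (Real.exp_pos _).le
    · exact (Real.exp_pos _).le
  have hEε : E ≤ ε / (max C 0 + 1) := hR.trans hD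
  calc ‖∑ n ∈ Ioc 0 ⌊y⌋₊, ((μ n : ℤ) : ℂ) * χ (n : ZMod (2 ^ γ))‖ ≤ C * y * E := hB
    _ ≤ max C 0 * y * E := by gcongr; exact le_max_left _ _
    _ ≤ max C 0 * y * (ε / (max C 0 + 1)) := by gcongr
    _ = (max C 0 / (max C 0 + 1)) * (ε * y) := by ring
    _ ≤ 1 * (ε * y) := by
        gcongr
        exact (div_le_one hC1).mpr (by linarith)
    _ = ε * y := one_mul _

/-! ## §4 The bounded-level range from Green's theorem (unconditional) -/

/-- **Bounded levels, unconditionally** (Green 2012 Thm 3 / Montgomery–Vaughan §11.3.1 Exercise 7 for `q = 2^t`, the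
tree's proved `LiouvilleTwoPower.norm_sum_moebius_character_le`): for every `G` and `ε > 0` there is `y₀` with
`‖Σ_{n ≤ y} μ(n) χ(n)‖ ≤ ε y` for all real `y ≥ y₀`, all `t ≤ G` and all characters `χ` mod `2^t`.
[cite: Green2012, Theorem 3] -/
theorem moebius_twisted_le_of_level_le (G : ℕ) :
    ∀ ε : ℝ, 0 < ε → ∃ y₀ : ℝ, ∀ y : ℝ, y₀ ≤ y → ∀ t : ℕ, t ≤ G → ∀ χ : DirichletCharacter ℂ (2 ^ t),
      ‖∑ n ∈ Ioc 0 ⌊y⌋₊, ((μ n : ℤ) : ℂ) * χ (n : ZMod (2 ^ t))‖ ≤ ε * y := by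
  intro ε hε
  obtain ⟨c, hc, C, hC0, h⟩ := Literature.NumberTheory.LFunctions.LiouvilleTwoPower.norm_sum_moebius_character_le
  -- `√(log y) ≥ A := max (G log 2 / c) (max (log ((C+1)/ε) / c) 0)` suffices
  set A : ℝ := max (G * Real.log 2 / c) (max (Real.log ((C + 1) / ε) / c) 0) with hA
  have hA0 : 0 ≤ A := le_trans (le_max_right _ _) (le_max_right _ _)
  refine ⟨max (Real.exp (A ^ 2)) 1, fun y hy t ht χ => ?_⟩
  have hy1 : (1 : ℝ) ≤ y := le_trans (le_max_right _ _) hy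
  have hy0 : 0 < y := by linarith
  have hlog : A ^ 2 ≤ Real.log y := by
    rw [← Real.log_exp (A ^ 2)]; exact Real.log_le_log (Real.exp_pos _) (le_trans (le_max_left _ _) hy)
  have hs : A ≤ Real.sqrt (Real.log y) := by
    rw [← Real.sqrt_sq hA0]; exact Real.sqrt_le_sqrt hlog
  -- the level condition `2^t ≤ 2^G ≤ exp(c √log y)`
  have hlev : (2 : ℝ) ^ t ≤ Real.exp (c * Real.sqrt (Real.log y)) := by
    have h2G : (2 : ℝ) ^ t ≤ (2 : ℝ) ^ G := pow_le_pow_right₀ (by norm_num) ht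
    have h2 : (2 : ℝ) ^ G = Real.exp (G * Real.log 2) := by
      rw [← Real.rpow_natCast, Real.rpow_def_of_pos (by norm_num : (0 : ℝ) < 2), mul_comm]
    refine h2G.trans ?_
    rw [h2, Real.exp_le_exp]
    have h3 : G * Real.log 2 / c ≤ Real.sqrt (Real.log y) := (le_max_left _ _).trans hs
    rw [div_le_iff₀ hc] at h3
    linarith
  refine (h t χ y hy1 hlev).trans ?_
  -- `C e^{-c√log y} ≤ ε`
  have hexp : Real.exp (-c * Real.sqrt (Real.log y)) ≤ ε / (C + 1) := by
    have h4 : Real.log ((C + 1) / ε) / c ≤ Real.sqrt (Real.log y) :=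
      ((le_max_left _ _).trans (le_max_right _ _)).trans hs
    rw [div_le_iff₀ hc] at h4
    calc Real.exp (-c * Real.sqrt (Real.log y))
        ≤ Real.exp (-Real.log ((C + 1) / ε)) := Real.exp_le_exp.mpr (by linarith)
      _ = ε / (C + 1) := by rw [Real.exp_neg, Real.exp_log (by positivity), inv_div]
  calc C * y * Real.exp (-c * Real.sqrt (Real.log y))
      ≤ C * y * (ε / (C + 1)) := by gcongr
    _ = C / (C + 1) * (ε * y) := by ring
    _ ≤ 1 * (ε * y) := by
        gcongr
        exact (div_le_one (by positivity)).mpr (by linarith)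
    _ = ε * y := one_mul _

/-! ## §5 Conductor bookkeeping for `2`-power moduli -/

/-- A Dirichlet character to a `2`-power modulus `2^t`, `t ≥ 1`, takes on `ℕ` the same values as a character `χ₀`
to a modulus `2^γ` with `1 ≤ γ ≤ t` which is either PRIMITIVE (`2^γ` the conductor of `χ`, when that conductor is
`> 1`) or the principal character mod `2` (`γ = 1`, when `χ` is principal): both `χ` and `χ₀` vanish exactly at the
even integers. [folklore] -/
theorem exists_sameValues_primitive_or_level_one (t : ℕ) (ht : 1 ≤ t) (χ : DirichletCharacter ℂ (2 ^ t)) :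
    ∃ γ : ℕ, 1 ≤ γ ∧ γ ≤ t ∧ ∃ χ₀ : DirichletCharacter ℂ (2 ^ γ), (χ₀.IsPrimitive ∨ γ = 1) ∧
      ∀ n : ℕ, χ (n : ZMod (2 ^ t)) = χ₀ (n : ZMod (2 ^ γ)) := by
  haveI : NeZero (2 ^ t) := ⟨pow_ne_zero _ two_ne_zero⟩
  -- the conductor is `2^γ'`, `γ' ≤ t`
  obtain ⟨γ', hγ't, hcond⟩ := (Nat.dvd_prime_pow Nat.prime_two).1 χ.conductor_dvd_level
  -- parity of `n` decides coprimality to every `2^s`, `s ≥ 1`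
  have hcop : ∀ (s : ℕ), 1 ≤ s → ∀ n : ℕ, IsCoprime (n : ℤ) ((2 ^ s : ℕ) : ℤ) ↔ Odd n := by
    intro s hs n
    rw [Nat.isCoprime_iff_coprime, Nat.coprime_pow_right_iff hs, Nat.coprime_two_right]
  rcases Nat.eq_zero_or_pos γ' with hγ'0 | hγ'pos
  · -- conductor `1`: `χ` is principal; use the principal character mod `2`
    rw [hγ'0, pow_zero] at hcond
    have hχ1 : χ = 1 := DirichletCharacter.eq_one_iff_conductor_eq_one.mpr hcond
    refine ⟨1, le_rfl, ht, 1, Or.inr rfl, fun n => ?_⟩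
    rw [hχ1]
    have h1 : IsUnit ((n : ℕ) : ZMod (2 ^ t)) ↔ Odd n := by
      rw [ZMod.isUnit_iff_coprime, Nat.coprime_pow_right_iff ht, Nat.coprime_two_right]
    have h2 : IsUnit ((n : ℕ) : ZMod (2 ^ 1)) ↔ Odd n := by
      rw [ZMod.isUnit_iff_coprime, Nat.coprime_pow_right_iff Nat.one_pos, Nat.coprime_two_right]
    by_cases hn : Odd n
    · rw [MulChar.one_apply (h1.mpr hn), MulChar.one_apply (h2.mpr hn)]
    · rw [MulChar.map_nonunit _ (fun h => hn (h1.mp h)), MulChar.map_nonunit _ (fun h => hn (h2.mp h))]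
  · -- conductor `2^γ'`, `γ' ≥ 1`: use the primitive character, transported to the level `2^γ'`
    haveI : NeZero χ.conductor := ⟨χ.conductor_ne_zero⟩
    have hdvd : χ.conductor ∣ 2 ^ γ' := dvd_of_eq hcond
    set χ₀ : DirichletCharacter ℂ (2 ^ γ') := DirichletCharacter.changeLevel hdvd χ.primitiveCharacter with hχ₀
    refine ⟨γ', hγ'pos, hγ't, χ₀, Or.inl ?_, fun n => ?_⟩
    · -- primitivity: the conductor is unchanged by `changeLevel` along an equality of levels
      rw [DirichletCharacter.isPrimitive_def, hχ₀, DirichletCharacter.conductor_changeLevel (χ := χ.primitiveCharacter) hdvd,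
        (DirichletCharacter.isPrimitive_def _).1 χ.primitiveCharacter_isPrimitive, hcond]
    · by_cases hn : Odd n
      · -- units: both sides are the primitive character at `n`
        have hct : IsCoprime (n : ℤ) ((2 ^ t : ℕ) : ℤ) := (hcop t ht n).mpr hn
        have hcγ : IsCoprime (n : ℤ) ((2 ^ γ' : ℕ) : ℤ) := (hcop γ' hγ'pos n).mpr hn
        have e1 := χ.primitiveCharacter_apply_of_isCoprime hct
        have e2 := DirichletCharacter.changeLevel_eq_cast_of_dvd' χ.primitiveCharacter hdvd hcγ
        simp only [Int.cast_natCast] at e1 e2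
        rw [hχ₀, e2, e1]
      · -- non-units: both sides vanish
        have hct : ¬ IsCoprime (n : ℤ) ((2 ^ t : ℕ) : ℤ) := fun h => hn ((hcop t ht n).mp h)
        have hcγ : ¬ IsCoprime (n : ℤ) ((2 ^ γ' : ℕ) : ℤ) := fun h => hn ((hcop γ' hγ'pos n).mp h)
        have e1 := (χ.apply_eq_zero_iff (n : ℤ)).mpr hct
        have e2 := (χ₀.apply_eq_zero_iff (n : ℤ)).mpr hcγ
        simp only [Int.cast_natCast] at e1 e2
        rw [e1, e2]

/-! ## §6 Assembly -/

/-- **Möbius–character sums to `2`-power moduli up to the length are `o(y)`, from Banks–Shparlinski Thm 2.2**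
(CONDITIONAL on the named fact) and Green's theorem (tree): for every `ε > 0` there is `y₀` with
`‖Σ_{n ≤ y} μ(n) χ(n)‖ ≤ ε y` for all real `y ≥ y₀`, all `t` with `2^t ≤ y` and all characters `χ` mod `2^t`.
Conductors `2^γ ≥ 2^{γ₁}`: §3 (the character is primitive there); conductors below `2^{γ₁}`, the principal
character and `t = 0`: §4 with `G = γ₁`; transport between levels: §5. [cite: BanksShparlinski2019PowerfulModuli, Theorem 2.2 and the remark following it] -/
theorem moebius_twisted_le_of_BS (hBS : Literature.NumberTheory.LFunctions.BanksShparlinski2019_theorem22_twoPower) :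
    ∀ ε : ℝ, 0 < ε → ∃ y₀ : ℝ, ∀ y : ℝ, y₀ ≤ y → ∀ (t : ℕ) (χ : DirichletCharacter ℂ (2 ^ t)),
      (2 : ℝ) ^ t ≤ y →
        ‖∑ n ∈ Ioc 0 ⌊y⌋₊, ((ArithmeticFunction.moebius n : ℤ) : ℂ) * χ (n : ZMod (2 ^ t))‖ ≤ ε * y := by
  obtain ⟨γ₁, hlarge⟩ := moebius_twisted_le_of_BS_large hBS
  intro ε hε
  obtain ⟨y₁, hy₁⟩ := hlarge ε hε
  obtain ⟨y₂, hy₂⟩ := moebius_twisted_le_of_level_le (max γ₁ 1) ε hε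
  refine ⟨max y₁ y₂, fun y hy t χ hty => ?_⟩
  have hyy₁ : y₁ ≤ y := le_trans (le_max_left _ _) hy
  have hyy₂ : y₂ ≤ y := le_trans (le_max_right _ _) hy
  rcases Nat.eq_zero_or_pos t with rfl | ht
  · exact hy₂ y hyy₂ 0 (Nat.zero_le _) χ
  · obtain ⟨γ, hγ1, hγt, χ₀, hprim, hval⟩ := exists_sameValues_primitive_or_level_one t ht χ
    have hsum : ∑ n ∈ Ioc 0 ⌊y⌋₊, ((μ n : ℤ) : ℂ) * χ (n : ZMod (2 ^ t)) =
        ∑ n ∈ Ioc 0 ⌊y⌋₊, ((μ n : ℤ) : ℂ) * χ₀ (n : ZMod (2 ^ γ)) :=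
      sum_congr rfl fun n _ => by rw [hval n]
    rw [hsum]
    by_cases hP : γ₁ ≤ γ ∧ χ₀.IsPrimitive
    · -- large conductor: Banks–Shparlinski
      have hγy : (2 : ℝ) ^ γ ≤ y := le_trans (pow_le_pow_right₀ (by norm_num) hγt) hty
      exact hy₁ y hyy₁ γ hP.1 hγy χ₀ hP.2
    · -- bounded level: Green (`γ < γ₁`, or `γ = 1` for the principal character)
      have hγG : γ ≤ max γ₁ 1 := by
        rcases hprim with h | h
        · have : ¬ γ₁ ≤ γ := fun h' => hP ⟨h', h⟩
          exact le_trans (not_le.mp this).le (le_max_left _ _)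
        · exact h ▸ le_max_right _ _
      exact hy₂ y hyy₂ γ hγG χ₀

/-- **The registered stub `stub_twistedLiouvilleSmall`, conditional on Banks–Shparlinski 2019 Thm 2.2.**
`TwistedLiouvilleSmall` BY NAME from the named fact `BanksShparlinski2019_theorem22_twoPower` (NOT proved in the
tree), via `moebius_twisted_le_of_BS` and the unconditional transfer `twistedLiouvilleSmall_of_moebius` of the companion
file. [cite: BanksShparlinski2019PowerfulModuli, Theorem 2.2] -/
theorem twistedLiouvilleSmall_of_BS (hBS : Literature.NumberTheory.LFunctions.BanksShparlinski2019_theorem22_twoPower) : TwistedLiouvilleSmall :=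
  twistedLiouvilleSmall_of_moebius (moebius_twisted_le_of_BS hBS)

end Summit.ValiantsHypothesis.ValiantsHypothesis.Theorems.LiouvilleSarnak.AlignedTypeI.CharactersModTwoN
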